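import Literature.NumberTheory.LFunctions.Zhang2022.DHChainBarrierPrimes
import Literature.NumberTheory.LFunctions.Zhang2022.DHMenuConsistentP4
import HarnessLib

/-!
# B-DH-W, prime side: the `ψ`-ROWS of `Zhang2022.DH.MenuConsistentPrimes` on the (A)-world — row P1
# (Bennett–Martin–O'Bryant–Rechnitzer, Lemma 6.12) and the `ψ`-clause of the structural row S5
# (cell `landau-siegel`, family B-dh KILLED GIVEN E-057; §E item S-E-bd1-2 of E-18b, the ψ-side of the split by datum)

Topic `Literature/NumberTheory/LFunctions/Zhang2022` (namespace `Literature.NumberTheory.LFunctions.Zhang2022.DH`,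
next to `DHChainBarrierPrimes.lean` = the statement `MenuConsistentPrimes` of ls-Bdh-typer-2 and
`DHMenuConsistentP4.lean` = the world's numerics at `log D ≥ 43 250`). Everything here is PROVED; no named fact,
no definition, no `L`-function, no prime.

What is proved. The two fields of `PrimeMenu (world D χ) (primeWorld D χ)` that read the LONG-INTERVAL datum
`(world D χ).psi q a x` of `DHChainBarrier.lean` — the Siegel main term `ψ_W(x; q, a) = (x − s·x^{β₁}/β₁)/φ(q)` on
residues `a` coprime to `q`, `s = Re χ(a mod D)` on the induced moduli `D ∣ q` and `s = 0` otherwise, `0` on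
non-coprime residues (`world_psi`) — are discharged with the field's statement copied verbatim:
* `world_rowP1` = `PrimeMenu.rowP1` (Bennett–Martin–O'Bryant–Rechnitzer 2018, Lemma 6.12, BOTH clauses) for
  `w := world D χ`, `log D ≥ 43 250`, `χ` quadratic. Off the induced moduli `ψ_W = x/φ(q)` and both clauses read
  `0 ≤ RHS`. On an induced modulus `|ψ_W − x/φ| = |s|·x^{β₁}/(β₁φ) ≤ x^{β₁}/(β₁φ)`; clause 1 because
  `1 − β₁ = δ(log D) > 100·e^{−(log D)/2}/(log D)² ≥ 40/(√q log²q)` (`DHMenuLines.bordignon_lt_delta`, `q ≥ D`) makes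
  `x^{β₁} ≤ x^{1 − 40/(√q log²q)}` for `x ≥ 1`, and `1/β₁ ≤ 1.012`; clause 2 because its hypothesis ("no quadratic
  character mod `q` has a real zero in `[1 − 1/(R₁ log q), 1)`") applied to the induced quadratic slot, which HAS
  the zero `β₁`, forces `δ > 1/(R₁ log q)`, and then `x ≥ e^{4R₁ log²q}` gives, with `u = √(log x/R₁) ≥ 2 log q ≥ 1`,
  `x^{−δ} = e^{−δR₁u²} ≤ e^{−u²/log q} ≤ e^{−2u}`, so `x^{β₁}/(β₁φ) ≤ 2x e^{−2u} ≤ 1.4579·x·u·e^{−u} = errTerm x`.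
* `world_psi_nonneg_mono` = the third conjunct of `PrimeMenu.rowS5` for `w := world D χ`: `0 ≤ ψ_W(x;q,a) ≤ ψ_W(x';q,a)`
  for `3 ≤ x ≤ x'`, from the two real-variable lemmas `rpow_sub_rpow_le` (`x'^β − x^β ≤ β(x' − x)` on `1 ≤ x ≤ x'`,
  `0 ≤ β ≤ 1`: Bernoulli) and `rpow_le_mul_self_of_three_le` (`x^β ≤ β·x` for `x ≥ 3` once `1 − β ≤ 1/13`, via
  `3^{−δ} ≤ 1/(1 + δ log 3) ≤ 1 − δ` and `log 3 > 13/12`).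
The θ-rows (`rowP2`–`rowP6`, `rowS5` conjuncts 1–2, on `primeWorld`)
and the assembly `menuConsistentPrimes_holds` are ls-Bdh-typer-2's / ls-barrier-p4's (E-18b RE-CUT OF RECORD, ls-barrier-plan
INBOX 2026-08-26T21:45:27Z + 21:53:22Z: split by datum; this file = item S-E-bd1-2, imported there by name).

WHAT THIS IS NOT: not a proof of `MenuConsistentPrimes`; no statement about primes in progressions or any actual
`L`-function; no verdict. «The programme SEARCHES and TYPES; no claim about Landau–Siegel zeros, Theorems 1–2 of
arXiv:2211.02515 or a repaired Margin232 until a kernel theorem says so.»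

## References

* `pub/landau-siegel/B-dh/KILL-draft.md` v1.4.5 §2 P7 / §3, `B-dh/EDLIST.md` v1.5 row dhE-22 (= E-055, M_primes).
* [BennettMartinOBryantRechnitzer2018] Definition 6.1, Lemma 6.12; [ThornerZaman2024PNTAP] Theorem 1 (1.4);
  [Zhang2022LandauSiegel] §2 Assumption (A); [MontgomeryVaughan2007] §4.3, §11.2.
-/

noncomputable section

open scoped Classical
open Complex

namespace Literature.NumberTheory.LFunctions.Zhang2022.DH

/-! ### 1. Real-variable lemmas -/

/-- Bernoulli for a real exponent `0 ≤ β ≤ 1` on `[1, ∞)`: `x'^β − x^β ≤ β (x' − x)` for `1 ≤ x ≤ x'`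
(the secant slope of `t ↦ t^β` beyond `1` is at most `β·x^{β−1} ≤ β`). [cite: MontgomeryVaughan2007, §4.3] -/
theorem rpow_sub_rpow_le {β x x' : ℝ} (hβ0 : 0 ≤ β) (hβ1 : β ≤ 1) (hx : 1 ≤ x) (hxx' : x ≤ x') :
    x' ^ β - x ^ β ≤ β * (x' - x) := by
  have hx0 : 0 < x := by linarith
  set s : ℝ := x' / x - 1 with hs
  have hs1 : -1 ≤ s := by
    have : 0 ≤ x' / x := div_nonneg (by linarith) hx0.le
    linarith
  have hx' : x' = x * (1 + s) := by rw [hs]; field_simp; ring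
  have h1s : 0 ≤ 1 + s := by linarith
  have hbern : (1 + s) ^ β ≤ 1 + β * s := rpow_one_add_le_one_add_mul_self hs1 hβ0 hβ1
  have hmul : x' ^ β = x ^ β * (1 + s) ^ β := by rw [hx', Real.mul_rpow hx0.le h1s]
  have hxβ : 0 ≤ x ^ β := Real.rpow_nonneg hx0.le β
  -- `x^β ≤ x` since `x^{β} = x^{β-1}·x` and `x^{β-1} ≤ 1`
  have hxβ1 : x ^ (β - 1) ≤ 1 := Real.rpow_le_one_of_one_le_of_nonpos hx (by linarith)
  have hsplit : x ^ β = x ^ (β - 1) * x := by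
    rw [show β = (β - 1) + 1 by ring, Real.rpow_add hx0, Real.rpow_one]; ring_nf
  have hxβx : x ^ β ≤ x := by
    rw [hsplit]; nlinarith
  have hs0 : 0 ≤ s := by
    rw [hs]; have : 1 ≤ x' / x := by rw [le_div_iff₀ hx0]; linarith
    linarith
  calc x' ^ β - x ^ β = x ^ β * ((1 + s) ^ β - 1) := by rw [hmul]; ring
    _ ≤ x ^ β * (β * s) := by apply mul_le_mul_of_nonneg_left _ hxβ; linarith
    _ = (x ^ β) * s * β := by ring
    _ ≤ x * s * β := by
        apply mul_le_mul_of_nonneg_right _ hβ0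
        exact mul_le_mul_of_nonneg_right hxβx hs0
    _ = β * (x' - x) := by rw [hx']; ring

/-- `log 3 > 13/12` (`e^{13/12} = e·e^{1/12} ≤ 2.7182818286·(12/11) < 3`). [cite: MontgomeryVaughan2007, §4.3] -/
theorem log_three_gt : (13 : ℝ) / 12 < Real.log 3 := by
  rw [Real.lt_log_iff_exp_lt (by norm_num)]
  have h1 : Real.exp (13 / 12) = Real.exp 1 * Real.exp (1 / 12) := by
    rw [← Real.exp_add]; norm_num
  -- `e^{1/12} ≤ 1/(1 - 1/12) = 12/11` from `1 - 1/12 ≤ e^{-1/12}`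
  have h2 : Real.exp (1 / 12) ≤ 12 / 11 := by
    have h := Real.add_one_le_exp (-(1 / 12 : ℝ))
    rw [Real.exp_neg] at h
    have hpos : 0 < Real.exp (1 / 12) := Real.exp_pos _
    rw [le_inv_comm₀ (by norm_num) hpos] at h
    have : ((-(1 / 12 : ℝ)) + 1)⁻¹ = 12 / 11 := by norm_num
    linarith [this ▸ h]
  rw [h1]
  have h3 := Real.exp_one_lt_d9
  have h4 : 0 < Real.exp (1 / 12) := Real.exp_pos _
  nlinarith

/-- `x^β ≤ β·x` for `x ≥ 3` when `0 ≤ 1 − β ≤ 1/13`: `x^{β−1} ≤ 3^{−δ} = e^{−δ log 3} ≤ 1/(1 + δ log 3) ≤ 1 − δ`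
(`δ = 1 − β`; the last step is `δ ≤ 1 − 1/log 3`, true since `log 3 > 13/12`). [cite: MontgomeryVaughan2007, §4.3] -/
theorem rpow_le_mul_self_of_three_le {β x : ℝ} (hβ1 : β ≤ 1) (hδ : 1 - β ≤ 1 / 13) (hx : 3 ≤ x) :
    x ^ β ≤ β * x := by
  have hx0 : 0 < x := by linarith
  set δ : ℝ := 1 - β with hδdef
  have hδ0 : 0 ≤ δ := by rw [hδdef]; linarith
  have hsplit : x ^ β = x ^ (β - 1) * x := by
    rw [show β = (β - 1) + 1 by ring, Real.rpow_add hx0, Real.rpow_one]; ring_nf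
  -- `x^{β-1} ≤ 3^{β-1}`
  have hmono : x ^ (β - 1) ≤ (3 : ℝ) ^ (β - 1) :=
    Real.rpow_le_rpow_of_nonpos (by norm_num) hx (by linarith)
  -- `3^{β-1} = e^{-δ log 3} ≤ 1/(1 + δ log 3)`
  have hlog3 := log_three_gt
  have h3 : (3 : ℝ) ^ (β - 1) = Real.exp (-(δ * Real.log 3)) := by
    rw [Real.rpow_def_of_pos (by norm_num : (0 : ℝ) < 3), hδdef]; ring_nf
  have hy0 : 0 ≤ δ * Real.log 3 := mul_nonneg hδ0 (by linarith)
  have hexp : Real.exp (-(δ * Real.log 3)) ≤ 1 / (1 + δ * Real.log 3) := by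
    have h := Real.add_one_le_exp (δ * Real.log 3)
    have hpos : 0 < δ * Real.log 3 + 1 := by linarith
    rw [Real.exp_neg, inv_eq_one_div, div_le_div_iff₀ (Real.exp_pos _) (by linarith), one_mul, one_mul]
    linarith
  -- `1/(1 + δ log 3) ≤ 1 − δ` iff `δ (1 + δ log 3) ≤ δ log 3` iff `1 + δ log 3 ≤ log 3` (or `δ = 0`)
  have hfrac : 1 / (1 + δ * Real.log 3) ≤ 1 - δ := by
    rw [div_le_iff₀ (by linarith)]
    -- goal: `1 ≤ (1 - δ) * (1 + δ * log 3)`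
    have hδlog : δ * Real.log 3 ≤ Real.log 3 - 1 := by
      have : δ * Real.log 3 ≤ (1 / 13) * Real.log 3 := mul_le_mul_of_nonneg_right hδ (by linarith)
      nlinarith
    nlinarith
  have hxβ1 : x ^ (β - 1) ≤ β := by
    have : (1 : ℝ) - δ = β := by rw [hδdef]; ring
    linarith [hmono, h3 ▸ hexp]
  rw [hsplit]
  exact mul_le_mul_of_nonneg_right hxβ1 hx0.le

/-- The de la Vallée-Poussin comparison used in clause 2 of row P1: for `u ≥ 1`, `2·e^{−2u} ≤ 1.4579·u·e^{−u}`.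
[cite: BennettMartinOBryantRechnitzer2018, Lemma 6.12] -/
theorem two_exp_neg_two_mul_le {u : ℝ} (hu : 1 ≤ u) :
    2 * Real.exp (-(2 * u)) ≤ 1.4579 * u * Real.exp (-u) := by
  have hsq : Real.exp (-(2 * u)) = Real.exp (-u) * Real.exp (-u) := by rw [← Real.exp_add]; ring_nf
  have hE : 0 < Real.exp (-u) := Real.exp_pos _
  -- `e^{-u} ≤ e^{-1} ≤ 1/2`
  have h1 : Real.exp (-u) ≤ Real.exp (-1) := Real.exp_le_exp.mpr (by linarith)
  have h2 : Real.exp (-1) ≤ 1 / 2 := by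
    rw [Real.exp_neg, inv_eq_one_div, div_le_div_iff₀ (Real.exp_pos 1) (by norm_num)]
    linarith [Real.exp_one_gt_d9]
  rw [hsq]
  nlinarith [mul_le_mul_of_nonneg_left (h1.trans h2) hE.le]

/-! ### 2. The world's `ψ(x; q, a)` datum -/

section World

variable {D : ℕ} {χ : DirichletCharacter ℂ D}

/-- The `ψ`-field of `world D χ`: Siegel main terms on the induced moduli, `x/φ(q)` elsewhere, on residues coprime
to `q`; `0` on the other residues. [cite: Zhang2022LandauSiegel, §2 Assumption (A)] -/
theorem world_psi (q a : ℕ) (x : ℝ) :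
    (world D χ).psi q a x =
      if Nat.Coprime a q then
        (x - (if D ∣ q then (χ (a : ZMod D)).re * x ^ betaExc D / betaExc D else 0)) / Nat.totient q
      else 0 := rfl

/-- The Siegel sign is at most one in absolute value: `|Re χ(a)| ≤ ‖χ(a)‖ ≤ 1`.
[cite: MontgomeryVaughan2007, §4.3] -/
theorem abs_re_chi_le_one (a : ZMod D) : |(χ a).re| ≤ 1 :=
  (Complex.abs_re_le_norm _).trans (DirichletCharacter.norm_le_one χ a)

variable (hL : (43250 : ℝ) ≤ Real.log D)
include hL

/-- `1/β₁(D) ≤ 1.012`, indeed `β₁(D) > 1 − 1/432 500`. [cite: BennettMartinOBryantRechnitzer2018, Lemma 6.12] -/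
theorem one_le_betaExc_mul : 1 ≤ 1.012 * betaExc D := by
  have h := (betaExc_window hL).1
  have hl : 0 < Real.log (D : ℝ) := log_pos_of_hL hL
  have : 1 / (10 * Real.log D) ≤ 1 / (10 * 43250) :=
    div_le_div_of_nonneg_left (by norm_num) (by norm_num) (by linarith)
  nlinarith

/-- `40/(√q log²q) ≤ 1 − β₁(D)` for every `q ≥ D` (`√q log²q ≥ e^{(log D)/2}(log D)²` and
`100 e^{−L/2}/L² < δ(L)` = `DHMenuLines.bordignon_lt_delta`). [cite: BenliGoelTwissZaman2025, Theorem 2.8] -/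
theorem forty_div_le_one_sub_betaExc {q : ℕ} (hDq : (D : ℝ) ≤ q) :
    40 / (Real.sqrt q * Real.log q ^ 2) ≤ 1 - betaExc D := by
  have hD0 := cast_pos_of_hL hL
  have hl0 := log_pos_of_hL hL
  set L := Real.log (D : ℝ) with hLdef
  have hδ : 1 - betaExc D = DHMenuLines.delta L := one_sub_betaExc D
  have hlogq : L ≤ Real.log q := Real.log_le_log hD0 hDq
  have hsqrt : Real.exp (L / 2) ≤ Real.sqrt q := by
    rw [← sqrt_cast_eq_exp hL]; exact Real.sqrt_le_sqrt hDq
  have hE : 0 < Real.exp (L / 2) := Real.exp_pos _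
  have hden : Real.exp (L / 2) * L ^ 2 ≤ Real.sqrt q * Real.log q ^ 2 := by
    have h2 : L ^ 2 ≤ Real.log q ^ 2 := pow_le_pow_left₀ hl0.le hlogq 2
    exact mul_le_mul hsqrt h2 (by positivity) (Real.sqrt_nonneg _)
  have hB := DHMenuLines.bordignon_lt_delta hL
  have hB' : 100 * Real.exp (-(L / 2)) / L ^ 2 = 100 / (Real.exp (L / 2) * L ^ 2) := by
    rw [Real.exp_neg]; field_simp
  rw [hB'] at hB
  have hmono : 40 / (Real.sqrt q * Real.log q ^ 2) ≤ 40 / (Real.exp (L / 2) * L ^ 2) :=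
    div_le_div_of_nonneg_left (by norm_num) (by positivity) hden
  have h40 : 40 / (Real.exp (L / 2) * L ^ 2) ≤ 100 / (Real.exp (L / 2) * L ^ 2) :=
    div_le_div_of_nonneg_right (by norm_num) (by positivity)
  linarith

/-- On an induced modulus the Siegel term is at most `x^{β₁}/(β₁ φ(q))` in absolute value:
`|ψ_W(x;q,a) − x/φ(q)| ≤ x^{β₁}/(β₁φ(q))` for `x > 0` and `a` coprime to `q` (any modulus).
[cite: ThornerZaman2024PNTAP, Theorem 1 (1.4)] -/
theorem abs_world_psi_sub_le {q a : ℕ} (hq : 0 < q) (ha : Nat.Coprime a q) {x : ℝ} (hx : 0 < x) :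
    |(world D χ).psi q a x - x / Nat.totient q| ≤ x ^ betaExc D / (betaExc D * Nat.totient q) := by
  have hβ : 0 < betaExc D := by linarith [half_lt_betaExc hL]
  have hφ : (0 : ℝ) < Nat.totient q := by exact_mod_cast Nat.totient_pos.mpr hq
  have hxβ : 0 < x ^ betaExc D := Real.rpow_pos_of_pos hx _
  rw [world_psi, if_pos ha]
  split_ifs with hd
  · have hs := abs_re_chi_le_one (χ := χ) (a : ZMod D)
    have hval : (x - (χ (a : ZMod D)).re * x ^ betaExc D / betaExc D) / Nat.totient q - x / Nat.totient q =
        -((χ (a : ZMod D)).re * (x ^ betaExc D / (betaExc D * Nat.totient q))) := by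
      field_simp; ring
    rw [hval, abs_neg, abs_mul]
    have hnn : 0 ≤ x ^ betaExc D / (betaExc D * Nat.totient q) := by positivity
    rw [abs_of_nonneg hnn]
    calc |(χ (a : ZMod D)).re| * (x ^ betaExc D / (betaExc D * Nat.totient q))
        ≤ 1 * (x ^ betaExc D / (betaExc D * Nat.totient q)) := mul_le_mul_of_nonneg_right hs hnn
      _ = x ^ betaExc D / (betaExc D * Nat.totient q) := one_mul _
  · have : (x - 0) / (Nat.totient q : ℝ) - x / Nat.totient q = 0 := by ring
    rw [this, abs_zero]; positivity

/-! ### 3. Row P1 on the world (Bennett–Martin–O'Bryant–Rechnitzer, Lemma 6.12, both clauses) -/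

/-- **Row P1 of the prime menu on the world** = `PrimeMenu.rowP1` VERBATIM for `w := world D χ` (`log D ≥ 43 250`,
`χ` quadratic): for `q ≥ 10⁵`, units `a`, `x ≥ e^{4R₁ log²q}`, the two-term bound
`|ψ_W − x/φ| ≤ (1.012/φ)x^{1 − 40/(√q log²q)} + errTerm x`, and the one-term bound `≤ errTerm x` under "no quadratic
character mod `q` has a real zero in `[1 − 1/(R₁ log q), 1)`" read over the world.
[cite: BennettMartinOBryantRechnitzer2018, Lemma 6.12] -/
theorem world_rowP1 (hquad : χ.IsQuadratic) : ∀ (q : ℕ) [NeZero q], 10 ^ 5 ≤ q → ∀ (a : (ZMod q)ˣ) (x : ℝ),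
    Real.exp (4 * BMOR2018.R₁ * Real.log q ^ 2) ≤ x →
      |(world D χ).psi q (a : ZMod q).val x - x / q.totient| ≤
          1.012 / q.totient * x ^ (1 - 40 / (Real.sqrt q * Real.log q ^ 2)) + BMOR2018.errTerm x ∧
      ((∀ χ_1 : DirichletCharacter ℂ q, χ_1.IsQuadratic →
          ∀ β : ℝ, 1 - 1 / (BMOR2018.R₁ * Real.log q) ≤ β → β < 1 → ¬ (world D χ).IsZero q χ_1 β) →
        |(world D χ).psi q (a : ZMod q).val x - x / q.totient| ≤ BMOR2018.errTerm x) := by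
  intro q _ hq a x hx
  have hD0 := cast_pos_of_hL hL
  have hl0 := log_pos_of_hL hL
  have hβw := betaExc_window hL
  have hβhalf := half_lt_betaExc hL
  have hβ0 : 0 < betaExc D := by linarith
  set β := betaExc D with hβdef
  have hq0 : 0 < q := lt_of_lt_of_le (by norm_num) hq
  have hq1 : (1 : ℝ) < q := by exact_mod_cast lt_of_lt_of_le (by norm_num) hq
  have hlogq : 0 < Real.log (q : ℝ) := Real.log_pos hq1
  have hlogq1 : 1 ≤ Real.log (q : ℝ) := by
    -- `q ≥ 10⁵ ≥ 3 > e`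
    have h3 : Real.log 3 ≤ Real.log (q : ℝ) :=
      Real.log_le_log (by norm_num) (by exact_mod_cast le_trans (by norm_num) hq)
    linarith [log_three_gt]
  have hR := BMOR2018.R₁_pos
  have harg : 0 ≤ 4 * BMOR2018.R₁ * Real.log q ^ 2 := by positivity
  have hx1 : 1 ≤ x := le_trans (Real.one_le_exp harg) hx
  have hx0 : 0 < x := by linarith
  have hφ : (0 : ℝ) < Nat.totient q := by exact_mod_cast Nat.totient_pos.mpr hq0
  have hφ1 : (1 : ℝ) ≤ Nat.totient q := by exact_mod_cast Nat.totient_pos.mpr hq0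
  have hcop : Nat.Coprime (a : ZMod q).val q := ZMod.val_coe_unit_coprime a
  have herr : 0 ≤ BMOR2018.errTerm x := by unfold BMOR2018.errTerm; positivity
  have hmain := abs_world_psi_sub_le hL (χ := χ) hq0 hcop hx0
  have hxβ : 0 < x ^ β := Real.rpow_pos_of_pos hx0 _
  by_cases hd : D ∣ q
  · -- the induced modulus: `q ≥ D`
    have hDq : (D : ℝ) ≤ q := by exact_mod_cast Nat.le_of_dvd hq0 hd
    have hLq : Real.log (D : ℝ) ≤ Real.log q := Real.log_le_log hD0 hDq
    constructor
    · -- clause 1: `x^β/(βφ) ≤ (1.012/φ) x^{e₁}`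
      have hδ := forty_div_le_one_sub_betaExc hL hDq
      have he : β ≤ 1 - 40 / (Real.sqrt q * Real.log q ^ 2) := by rw [hβdef]; linarith
      have hpow : x ^ β ≤ x ^ (1 - 40 / (Real.sqrt q * Real.log q ^ 2)) :=
        Real.rpow_le_rpow_of_exponent_le hx1 he
      have h1012 := one_le_betaExc_mul hL
      have hxe : 0 < x ^ (1 - 40 / (Real.sqrt q * Real.log q ^ 2)) := Real.rpow_pos_of_pos hx0 _
      have hstep : x ^ β / (β * Nat.totient q) ≤
          1.012 / Nat.totient q * x ^ (1 - 40 / (Real.sqrt q * Real.log q ^ 2)) := by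
        rw [div_le_iff₀ (by positivity)]
        have : 1.012 / (Nat.totient q : ℝ) * x ^ (1 - 40 / (Real.sqrt q * Real.log q ^ 2)) * (β * Nat.totient q) =
            (1.012 * β) * x ^ (1 - 40 / (Real.sqrt q * Real.log q ^ 2)) := by
          field_simp
        rw [this]
        nlinarith
      linarith
    · -- clause 2: the hypothesis forces `δ > 1/(R₁ log q)`
      intro H
      have hψq : (DirichletCharacter.changeLevel hd χ).IsQuadratic :=
        MulChar.isQuadratic_iff_sq_eq_one.mpr (by rw [← map_pow, hquad.sq_eq_one, map_one])
      have hz : (world D χ).IsZero q (DirichletCharacter.changeLevel hd χ) (β : ℂ) := by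
        rw [isZero_world_iff]
        exact Or.inr ⟨⟨hd, rfl⟩, (mem_excPair_iff).mpr (Or.inl rfl)⟩
      have hβR : β < 1 - 1 / (BMOR2018.R₁ * Real.log q) := by
        by_contra hcon
        push Not at hcon
        exact H _ hψq β hcon hβw.2 hz
      -- `u = √(log x / R₁) ≥ 2 log q ≥ 1`
      have hlogx : 4 * BMOR2018.R₁ * Real.log q ^ 2 ≤ Real.log x := by
        have := Real.log_le_log (Real.exp_pos _) hx
        rwa [Real.log_exp] at this
      have hlogx0 : 0 ≤ Real.log x := Real.log_nonneg hx1
      set u := Real.sqrt (Real.log x / BMOR2018.R₁) with hudef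
      have hu0 : 0 ≤ u := Real.sqrt_nonneg _
      have husq : u ^ 2 = Real.log x / BMOR2018.R₁ := Real.sq_sqrt (div_nonneg hlogx0 hR.le)
      have hu2 : 2 * Real.log q ≤ u := by
        have h4 : (2 * Real.log q) ^ 2 ≤ Real.log x / BMOR2018.R₁ := by
          rw [le_div_iff₀ hR]; nlinarith
        calc 2 * Real.log q = Real.sqrt ((2 * Real.log q) ^ 2) := (Real.sqrt_sq (by positivity)).symm
          _ ≤ u := Real.sqrt_le_sqrt h4
      have hu1 : 1 ≤ u := by linarith
      -- `x^β = x · e^{−δ log x}` and `δ log x ≥ u²/log q ≥ 2u`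
      have hxβeq : x ^ β = x * Real.exp (-((1 - β) * Real.log x)) := by
        rw [Real.rpow_def_of_pos hx0]
        have : Real.log x * β = Real.log x + (-((1 - β) * Real.log x)) := by ring
        rw [this, Real.exp_add, Real.exp_log hx0]
      have hδlog : 2 * u ≤ (1 - β) * Real.log x := by
        have hδ' : 1 / (BMOR2018.R₁ * Real.log q) < 1 - β := by linarith
        have hlx : Real.log x = BMOR2018.R₁ * u ^ 2 := by rw [husq]; field_simp
        -- `(1-β) log x ≥ log x /(R₁ log q) = u²/log q ≥ 2u`
        have h1 : Real.log x / (BMOR2018.R₁ * Real.log q) ≤ (1 - β) * Real.log x := by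
          rw [div_eq_mul_one_div, mul_comm]
          exact mul_le_mul_of_nonneg_right hδ'.le hlogx0
        have h2 : Real.log x / (BMOR2018.R₁ * Real.log q) = u ^ 2 / Real.log q := by
          rw [hlx]; field_simp
        have h3 : 2 * u ≤ u ^ 2 / Real.log q := by
          rw [le_div_iff₀ hlogq]; nlinarith
        linarith
      have hexp : Real.exp (-((1 - β) * Real.log x)) ≤ Real.exp (-(2 * u)) :=
        Real.exp_le_exp.mpr (by linarith)
      have hcmp := two_exp_neg_two_mul_le hu1
      -- assemble: `x^β/(βφ) ≤ 2 x e^{-2u} ≤ 1.4579 x u e^{-u}`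
      have hinv : 1 / (β * (Nat.totient q : ℝ)) ≤ 2 := by
        rw [div_le_iff₀ (by positivity)]; nlinarith
      have hstep : x ^ β / (β * Nat.totient q) ≤ BMOR2018.errTerm x := by
        unfold BMOR2018.errTerm
        rw [← hudef, hxβeq]
        have hE2 : 0 < Real.exp (-(2 * u)) := Real.exp_pos _
        calc x * Real.exp (-((1 - β) * Real.log x)) / (β * Nat.totient q)
            = x * Real.exp (-((1 - β) * Real.log x)) * (1 / (β * Nat.totient q)) := by ring
          _ ≤ x * Real.exp (-(2 * u)) * 2 := by
              apply mul_le_mul _ hinv (by positivity) (by positivity)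
              exact mul_le_mul_of_nonneg_left hexp hx0.le
          _ = x * (2 * Real.exp (-(2 * u))) := by ring
          _ ≤ x * (1.4579 * u * Real.exp (-u)) := mul_le_mul_of_nonneg_left hcmp hx0.le
          _ = 1.4579 * x * u * Real.exp (-u) := by ring
      linarith
  · -- off the induced moduli: `ψ_W = x/φ`
    have hzero : (world D χ).psi q (a : ZMod q).val x - x / q.totient = 0 := by
      rw [world_psi, if_pos hcop, if_neg hd]; ring
    rw [hzero, abs_zero]
    exact ⟨by positivity, fun _ => herr⟩

/-! ### 4. Row S5, the `ψ`-clause, on the world -/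

/-- **Row S5, third conjunct, on the world** = the `ψ`-clause of `PrimeMenu.rowS5` VERBATIM for `w := world D χ`
(`log D ≥ 43 250`): `0 ≤ ψ_W(x;q,a) ≤ ψ_W(x';q,a)` for `3 ≤ x ≤ x'` (any modulus `q`, any residue `a`).
[cite: ThornerZaman2024PNTAP, Theorem 1 (1.4)] -/
theorem world_psi_nonneg_mono : ∀ (q : ℕ) [NeZero q] (a : ℕ) (x x' : ℝ), 3 ≤ x → x ≤ x' →
    0 ≤ (world D χ).psi q a x ∧ (world D χ).psi q a x ≤ (world D χ).psi q a x' := by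
  intro q _ a x x' hx hxx'
  have hβw := betaExc_window hL
  have hβhalf := half_lt_betaExc hL
  have hl0 := log_pos_of_hL hL
  set β := betaExc D with hβdef
  have hβ0 : 0 < β := by linarith
  have hβ1 : β ≤ 1 := hβw.2.le
  have hδ13 : 1 - β ≤ 1 / 13 := by
    have : 1 / (10 * Real.log D) ≤ 1 / (10 * 43250) :=
      div_le_div_of_nonneg_left (by norm_num) (by norm_num) (by linarith)
    linarith [hβw.1]
  have hx0 : 0 < x := by linarith
  have hx1 : 1 ≤ x := by linarith
  have hx'0 : 0 < x' := by linarith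
  have hq0 : 0 < q := Nat.pos_of_ne_zero (NeZero.ne q)
  have hφ : (0 : ℝ) < Nat.totient q := by exact_mod_cast Nat.totient_pos.mpr hq0
  by_cases ha : Nat.Coprime a q
  · rw [world_psi, world_psi, if_pos ha, if_pos ha]
    -- the Siegel coefficient `c ∈ [-1, 1]`
    set c : ℝ := if D ∣ q then (χ (a : ZMod D)).re else 0 with hcdef
    have hc : |c| ≤ 1 := by
      rw [hcdef]; split_ifs
      · exact abs_re_chi_le_one (χ := χ) _
      · simp
    have hc1 : c ≤ 1 := (le_abs_self c).trans hc
    have hc1' : -1 ≤ c := by linarith [neg_abs_le c]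
    have hterm : ∀ y : ℝ, (if D ∣ q then (χ (a : ZMod D)).re * y ^ β / β else 0) = c * (y ^ β / β) := by
      intro y; rw [hcdef]; split_ifs <;> ring
    rw [hterm x, hterm x']
    have hxβ : 0 < x ^ β := Real.rpow_pos_of_pos hx0 _
    have hA := rpow_le_mul_self_of_three_le hβ1 hδ13 hx            -- `x^β ≤ β x`
    have hB := rpow_sub_rpow_le hβ0.le hβ1 hx1 hxx'                  -- `x'^β − x^β ≤ β (x' − x)`
    have hmono : x ^ β ≤ x' ^ β := Real.rpow_le_rpow hx0.le hxx' hβ0.le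
    constructor
    · -- `x − c x^β/β ≥ x − x^β/β ≥ 0`
      apply div_nonneg _ hφ.le
      have h1 : c * (x ^ β / β) ≤ x ^ β / β := by
        have : 0 ≤ x ^ β / β := by positivity
        nlinarith
      have h2 : x ^ β / β ≤ x := by rw [div_le_iff₀ hβ0]; linarith
      linarith
    · apply div_le_div_of_nonneg_right _ hφ.le
      -- `(x' − x) − c (x'^β − x^β)/β ≥ (x' − x) − (x'^β − x^β)/β ≥ 0`
      have hd0 : 0 ≤ (x' ^ β - x ^ β) / β := div_nonneg (by linarith) hβ0.le
      have h1 : c * (x' ^ β / β) - c * (x ^ β / β) ≤ (x' ^ β - x ^ β) / β := by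
        have : c * (x' ^ β / β) - c * (x ^ β / β) = c * ((x' ^ β - x ^ β) / β) := by ring
        rw [this]; nlinarith
      have h2 : (x' ^ β - x ^ β) / β ≤ x' - x := by rw [div_le_iff₀ hβ0]; linarith
      linarith
  · rw [world_psi, world_psi, if_neg ha, if_neg ha]
    exact ⟨le_rfl, le_rfl⟩

end World

end Literature.NumberTheory.LFunctions.Zhang2022.DH

end
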